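import Literature.Topology.FourManifolds.ProductRefinement
import HarnessLib

/-!
# One prism cell: its staircase expansions, horns and newness

The per-cell combinatorics of the engulfing induction (Rushing 1973, proof of Thm. 4.12.1,
Fact 2: the cell `σ × [t_{a-1}, t_a]` is engulfed through the elementary expansions across its
staircase simplices), extracted from the expansion order of the product complex
(`ExpansionOrder.lean`) in the special case of **one prism** — the full-simplex complex
`simplexCx τ` of an affinely independent vertex set `τ = l.toFinset` (`l` a duplicate-free
list), one slab `[u, u'] = [t 0, t 1]`, no base subfamily, nothing done before.  For the
staircase simplices `R_i = stair u u' l i`, `i < l.length`, with apex `p_i = (l[i], u)` (bottom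
copy) and upper free face `R_i ∖ {p_i}`:

* `facesSpace_prevFaces_zero_eq` — before the first expansion exactly the **horn of the cell**
  is present: `|prevFaces 0| = conv τ × {u} ∪ ⋃_{v ∈ τ} conv (τ ∖ {v}) × [u, u']` (bottom and
  walls);
* `facesSpace_prevFaces_succ_eq` — each expansion adds exactly `conv R_i`;
* `convexHull_erase_subset_facesSpace_prevFaces` — the horn of `R_i` at `p_i` is present
  (every facet through the apex; `erase_mem_prevFaces`);
* `not_convexHull_stair_subset`, `not_convexHull_eraseBot_subset` — **newness as sets**: neither
  `conv R_i` nor the closed free face is contained in what is present (from the combinatorial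
  `stair_notMem_prevFaces` / `erase_bot_notMem_prevFaces` through
  `Literature.Analysis.Convexity.mem_of_convexHull_subset_biUnion` in the product complex);
* `affineIndependent_stair`, `erase_bot_nonempty`, the cover
  `prismCell_subset_iUnion_convexHull_stair` / `prismCell_subset_facesSpace_prevFaces_length`
  (after the last expansion the whole cell `conv τ × [u, u']` is present), and
  `exists_of_mem_prevFaces_onePrism` (the present faces are prism faces over the nonempty
  `ρ ⊆ τ`, hence faces of the ambient product complex).

This is the input, cell by cell, of the iterated fine step `exists_homeomorph_expandSeq`
(`ExpansionInduction.lean`) in the refined (dynamic) form of the induction, where the cells of a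
block are processed one prism at a time after each re-approximation.  Everything is proved;
theorems only (no definition, no named fact).

## References

* T. B. Rushing, *Topological embeddings*, Academic Press (1973), proof of Thm. 4.12.1, Fact 2
  (the collapse `σ × [t_{a-1}, t_a] ↘ σ × t_{a-1} ∪ ∂σ × [t_{a-1}, t_a]` read backwards).
  [Rushing1973]
* C. P. Rourke, B. J. Sanderson, *Introduction to Piecewise-Linear Topology*, Springer (1972),
  Ch. 3. [RourkeSanderson1972]
-/

open Set Function

noncomputable section

namespace Literature.Topology.FourManifolds

open Literature.Analysis.Convexity

variable {W : Type*} [NormedAddCommGroup W] [NormedSpace ℝ W] [DecidableEq W]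

/-! ### The one-prism data -/

section OnePrism

variable (l : List W) (hl : l.Nodup) (hind : AffineIndependent ℝ ((↑) : ↥l.toFinset → W))
  {t : ℕ → ℝ} (ht : StrictMono t)

omit [NormedAddCommGroup W] [NormedSpace ℝ W] in
/-- The face list of the whole vertex set is the list itself. [folklore] -/
theorem faceList_toFinset_self : faceList l l.toFinset = l := by
  rw [faceList, List.filter_eq_self]
  intro w hw
  simpa using hw

/-- Every face of the full simplex complex has its vertices in the list. [folklore] -/
theorem simplexCx_faces_subset_toFinset :
    ∀ σ ∈ (simplexCx l.toFinset hind).faces, σ ⊆ l.toFinset := fun _ hσ => by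
  rw [simplexCx_faces] at hσ
  exact hσ.2

/-- The whole vertex set is a face of the full simplex complex (for a nonempty list).
[folklore] -/
theorem toFinset_mem_simplexCx_faces (hne : l ≠ []) :
    l.toFinset ∈ (simplexCx l.toFinset hind).faces := by
  rw [simplexCx_faces]
  obtain ⟨v, rest, rfl⟩ := List.exists_cons_of_ne_nil hne
  exact ⟨⟨v, by simp⟩, Finset.Subset.rfl⟩

include hl hind in
/-- **Staircase simplices are affinely independent.** [folklore] -/
theorem affineIndependent_stair (h01 : t 0 < t 1) (i : ℕ) (hi : i < l.length) :
    AffineIndependent ℝ ((↑) : ↥(stair (t 0) (t 1) l i) → W × ℝ) := by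
  obtain ⟨K, hK⟩ := exists_prismComplex h01 l hl hind
  have hmem : stair (t 0) (t 1) l i ∈ K.faces := by
    rw [hK]
    refine ⟨?_, i, hi, Finset.Subset.rfl⟩
    exact ⟨_, liftV_bot_getElem_mem_stair (t₀ := t 0) (t₁ := t 1) l i hi⟩
  exact K.indep hmem

omit [NormedAddCommGroup W] [NormedSpace ℝ W] in
/-- The free face of a staircase simplex (all but the apex) is nonempty. [folklore] -/
theorem erase_bot_nonempty (h01 : t 0 ≠ t 1) (i : ℕ) (hi : i < l.length) :
    ((stair (t 0) (t 1) l i).erase (liftV (t 0) l[i])).Nonempty := by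
  have h2 := two_le_card_stair h01 l i hi
  rw [← Finset.card_pos, Finset.card_erase_of_mem (liftV_bot_getElem_mem_stair l i hi)]
  omega

/-! ### What is present before and after each expansion -/

include hl hind in
/-- **The horn of the cell is what is present before the first expansion**: the faces present
before `R_0` (the base of the one-prism structure and the prisms over the proper faces) have
union `conv τ × {t 0} ∪ ⋃_{v ∈ τ} conv (τ ∖ {v}) × [t 0, t 1]`.
[cite: Rushing1973, proof of Thm. 4.12.1 (the cells `σ × t_{a-1}` and `∂σ × [t_{a-1}, t_a]`)] -/
theorem facesSpace_prevFaces_zero_eq (h01 : t 0 < t 1) :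
    facesSpace (prevFaces (simplexCx l.toFinset hind) l t 1 ∅ 0 ∅ l.toFinset 0) =
      prismLevel l.toFinset (t 0) ∪ ⋃ v ∈ l.toFinset, prismCell (l.toFinset.erase v) (t 0) (t 1) := by
  rw [prevFaces_zero]
  apply Subset.antisymm
  · intro p hp
    obtain ⟨F, hF, hpF⟩ := mem_facesSpace_iff.1 hp
    rcases hF with ((hF | ⟨a', ha', -⟩) | ⟨ρ, hρ, hcard, hFρ⟩) | ⟨τ, hτ, -⟩
    · -- base: bottom faces (the `Sub` part is empty)
      rcases hF with ⟨ρ, hρ, hne, hFρ⟩ | ⟨a, -, τ, hτ, -⟩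
      · left
        rw [simplexCx_faces] at hρ
        have hsub : (F : Set (W × ℝ)) ⊆ prismLevel l.toFinset (t 0) := fun q hq => by
          obtain ⟨v, hv, rfl⟩ := mem_bottomSimplex.1 (hFρ hq)
          refine ⟨subset_convexHull ℝ _ ?_, rfl⟩
          have : v ∈ faceList l ρ := hv
          rw [faceList, List.mem_filter] at this
          exact List.mem_toFinset.2 this.1
        exact (convexHull_min hsub ((convex_convexHull ℝ _).prod (convex_singleton _))) hpF
      · exact absurd hτ (notMem_empty _)
    · exact absurd ha' (Nat.not_lt_zero _)
    · -- prisms over proper faces: walls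
      right
      rw [simplexCx_faces] at hρ
      obtain ⟨v, hv, hvρ⟩ : ∃ v ∈ l.toFinset, v ∉ ρ := by
        by_contra h
        push Not at h
        exact absurd (Finset.card_le_card (fun v hv => h v hv)) (not_le.2 hcard)
      have hρv : ρ ⊆ l.toFinset.erase v := fun w hw =>
        Finset.mem_erase.2 ⟨fun hwv => hvρ (hwv ▸ hw), hρ.2 hw⟩
      have h1 := convexHull_subset_prismCell_of_mem_prismFaces h01 (faceList_nodup hl ρ) hFρ
      rw [faceList_toFinset hρ.2] at h1
      refine mem_iUnion₂.2 ⟨v, hv, ?_⟩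
      exact prismCell_mono (convexHull_mono (by exact_mod_cast hρv)) le_rfl le_rfl (h1 hpF)
    · exact absurd hτ (notMem_empty _)
  · rintro ⟨x, s⟩ (⟨hx, hs⟩ | hp)
    · -- the bottom level
      rw [mem_singleton_iff] at hs
      subst hs
      have hne : l ≠ [] := by
        rintro rfl
        simp at hx
      refine mem_facesSpace_iff.2 ⟨bottomSimplex (t 0) (faceList l l.toFinset), ?_, ?_⟩
      · refine Or.inl (Or.inl (Or.inl (Or.inl ⟨l.toFinset, toFinset_mem_simplexCx_faces l hind hne,
          ?_, Finset.Subset.rfl⟩)))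
        obtain ⟨v, rest, rfl⟩ := List.exists_cons_of_ne_nil hne
        refine ⟨liftV (t 0) v, mem_bottomSimplex.2 ⟨v, ?_, rfl⟩⟩
        rw [faceList_toFinset_self]
        exact List.mem_cons_self
      · rw [faceList_toFinset_self]
        exact mem_convexHull_bottomSimplex (by simpa using hx) rfl
    · -- the walls
      obtain ⟨v, hv, hxs⟩ := mem_iUnion₂.1 hp
      obtain ⟨hx, hs⟩ := hxs
      have hρne : (l.toFinset.erase v).Nonempty := by
        by_contra h
        rw [Finset.not_nonempty_iff_eq_empty] at h
        rw [h, Finset.coe_empty, convexHull_empty] at hx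
        exact hx
      set ρ := l.toFinset.erase v with hρdef
      have hρ : ρ ∈ (simplexCx l.toFinset hind).faces := by
        rw [simplexCx_faces]
        exact ⟨hρne, Finset.erase_subset v _⟩
      have hcard : ρ.card < l.toFinset.card := by
        rw [hρdef, Finset.card_erase_of_mem hv]
        exact Nat.sub_lt (Finset.card_pos.2 ⟨v, hv⟩) one_pos
      have hxρ : x ∈ convexHull ℝ (((faceList l ρ).toFinset : Finset W) : Set W) := by
        rwa [faceList_toFinset (Finset.erase_subset v _)]
      have hmem : ((x, s) : W × ℝ) ∈ prismSet (t 0) (t 1) (faceList l ρ) := ⟨hxρ, hs⟩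
      rw [← iUnion_prismFaces_eq h01 _ (faceList_nodup hl ρ)] at hmem
      obtain ⟨F, hF, hpF⟩ := mem_iUnion₂.1 hmem
      exact mem_facesSpace_iff.2 ⟨F, Or.inl (Or.inr ⟨ρ, hρ, hcard, hF⟩), hpF⟩

include hl hind ht in
/-- **Each expansion adds exactly one closed staircase simplex.** [folklore] -/
theorem facesSpace_prevFaces_succ_eq (i : ℕ) (hi : i < l.length) :
    facesSpace (prevFaces (simplexCx l.toFinset hind) l t 1 ∅ 0 ∅ l.toFinset (i + 1)) =
      facesSpace (prevFaces (simplexCx l.toFinset hind) l t 1 ∅ 0 ∅ l.toFinset i) ∪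
        convexHull ℝ (stair (t 0) (t 1) l i : Set (W × ℝ)) := by
  have hne : l ≠ [] := by rintro rfl; simp at hi
  have hi' : i < (faceList l l.toFinset).length := by rwa [faceList_toFinset_self]
  have h := prevFaces_succ (K := simplexCx l.toFinset hind) (N := 1) (Sub := ∅) (a := 0) (D := ∅)
    hl (simplexCx_faces_subset_toFinset l hind) ht (toFinset_mem_simplexCx_faces l hind hne) hi'
  simp only [faceList_toFinset_self] at h
  rw [h]
  apply Subset.antisymm
  · intro p hp
    obtain ⟨F, hF, hpF⟩ := mem_facesSpace_iff.1 hp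
    rcases hF with rfl | rfl | hF
    · exact Or.inr hpF
    · exact Or.inr (convexHull_mono (by rw [Finset.coe_erase]; exact sdiff_subset) hpF)
    · exact Or.inl (mem_facesSpace_iff.2 ⟨F, hF, hpF⟩)
  · rintro p (hp | hp)
    · obtain ⟨F, hF, hpF⟩ := mem_facesSpace_iff.1 hp
      exact mem_facesSpace_iff.2 ⟨F, Or.inr (Or.inr hF), hpF⟩
    · exact mem_facesSpace_iff.2 ⟨_, Or.inl rfl, hp⟩

include hl hind ht in
/-- **The horn of a staircase simplex is present**: every facet of `R_i` through the apex lies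
in what is present before the `i`-th expansion. [folklore] -/
theorem convexHull_erase_subset_facesSpace_prevFaces (i : ℕ) (hi : i < l.length)
    {q : W × ℝ} (hq : q ∈ stair (t 0) (t 1) l i) (hqa : q ≠ liftV (t 0) l[i]) :
    convexHull ℝ (((stair (t 0) (t 1) l i).erase q : Finset (W × ℝ)) : Set (W × ℝ)) ⊆
      facesSpace (prevFaces (simplexCx l.toFinset hind) l t 1 ∅ 0 ∅ l.toFinset i) := by
  have hne : l ≠ [] := by rintro rfl; simp at hi
  have hi' : i < (faceList l l.toFinset).length := by rwa [faceList_toFinset_self]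
  have h := fun (hq' : q ∈ stair (t 0) (t (0 + 1)) (faceList l l.toFinset) i)
      (hqa' : q ≠ liftV (t 0) (faceList l l.toFinset)[i]) =>
    erase_mem_prevFaces (K := simplexCx l.toFinset hind) (N := 1) (Sub := ∅) (a := 0)
      (D := ∅) hl (simplexCx_faces_subset_toFinset l hind) ht
      (toFinset_mem_simplexCx_faces l hind hne) hi' hq' hqa'
  simp only [faceList_toFinset_self] at h
  exact fun p hp => mem_facesSpace_iff.2 ⟨_, h hq hqa, hp⟩

/-! ### Newness as sets -/

include hl hind ht in
/-- **`conv R_i` is new**: it is not contained in what is present before the `i`-th expansion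
(else, the present faces being a down-closed subfamily of the product complex, `R_i` would be one
of them, contradicting `stair_notMem_prevFaces`). [folklore] -/
theorem not_convexHull_stair_subset (i : ℕ) (hi : i < l.length) :
    ¬ convexHull ℝ (stair (t 0) (t 1) l i : Set (W × ℝ)) ⊆
      facesSpace (prevFaces (simplexCx l.toFinset hind) l t 1 ∅ 0 ∅ l.toFinset i) := by
  have hne : l ≠ [] := by rintro rfl; simp at hi
  have hi' : i < (faceList l l.toFinset).length := by rwa [faceList_toFinset_self]
  have hKL := simplexCx_faces_subset_toFinset l hind
  have hσ := toFinset_mem_simplexCx_faces l hind hne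
  intro hsub
  -- the product complex of the one-prism structure
  set P1 := productComplex (simplexCx l.toFinset hind) l hl hKL t ht 1 with hP1
  have hA : prevFaces (simplexCx l.toFinset hind) l t 1 ∅ 0 ∅ l.toFinset i ⊆ P1.faces := by
    rw [hP1, productComplex_faces]
    refine prevFaces_subset_productFaces (empty_subset _) Nat.one_pos (empty_subset _) hσ ?_
    rw [faceList_toFinset_self]
    exact hi.le
  have hR : stair (t 0) (t 1) l i ∈ P1.faces := by
    rw [hP1, productComplex_faces]
    refine mem_productFaces_iff.2 ⟨0, Nat.one_pos, l.toFinset, hσ, ?_⟩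
    rw [faceList_toFinset_self]
    exact ⟨⟨_, liftV_bot_getElem_mem_stair l i hi⟩, i, hi, Finset.Subset.rfl⟩
  have hmem := mem_of_convexHull_subset_biUnion hA (fun ρ hρ r hr hrne => prevFaces_down_closed hρ hr hrne)
    hR (by intro p hp; exact mem_iUnion₂.2 (by
      obtain ⟨F, hF, hpF⟩ := mem_facesSpace_iff.1 (hsub hp); exact ⟨F, hF, hpF⟩))
  have hnot := stair_notMem_prevFaces (K := simplexCx l.toFinset hind) (N := 1) (Sub := ∅) (a := 0)
    (D := ∅) hl hKL ht hσ (empty_subset _) (fun _ h => absurd h (notMem_empty _))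
    (notMem_empty _) (fun _ h => absurd h (notMem_empty _)) hi'
  simp only [faceList_toFinset_self] at hnot
  exact hnot hmem

include hl hind ht in
/-- **The free face is new**: the closed upper free face `conv (R_i ∖ {p_i})` is not contained
in what is present before the `i`-th expansion (`erase_bot_notMem_prevFaces`). [folklore] -/
theorem not_convexHull_eraseBot_subset (i : ℕ) (hi : i < l.length) :
    ¬ convexHull ℝ (((stair (t 0) (t 1) l i).erase (liftV (t 0) l[i]) : Finset (W × ℝ)) :
        Set (W × ℝ)) ⊆
      facesSpace (prevFaces (simplexCx l.toFinset hind) l t 1 ∅ 0 ∅ l.toFinset i) := by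
  have hne : l ≠ [] := by rintro rfl; simp at hi
  have hi' : i < (faceList l l.toFinset).length := by rwa [faceList_toFinset_self]
  have hKL := simplexCx_faces_subset_toFinset l hind
  have hσ := toFinset_mem_simplexCx_faces l hind hne
  have h01 : t 0 ≠ t 1 := (ht Nat.one_pos).ne
  intro hsub
  set P1 := productComplex (simplexCx l.toFinset hind) l hl hKL t ht 1 with hP1
  have hA : prevFaces (simplexCx l.toFinset hind) l t 1 ∅ 0 ∅ l.toFinset i ⊆ P1.faces := by
    rw [hP1, productComplex_faces]
    refine prevFaces_subset_productFaces (empty_subset _) Nat.one_pos (empty_subset _) hσ ?_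
    rw [faceList_toFinset_self]
    exact hi.le
  have hR : (stair (t 0) (t 1) l i).erase (liftV (t 0) l[i]) ∈ P1.faces := by
    rw [hP1, productComplex_faces]
    refine mem_productFaces_iff.2 ⟨0, Nat.one_pos, l.toFinset, hσ, ?_⟩
    rw [faceList_toFinset_self]
    exact ⟨erase_bot_nonempty l h01 i hi, i, hi, Finset.erase_subset _ _⟩
  have hmem := mem_of_convexHull_subset_biUnion hA (fun ρ hρ r hr hrne => prevFaces_down_closed hρ hr hrne)
    hR (by intro p hp; exact mem_iUnion₂.2 (by
      obtain ⟨F, hF, hpF⟩ := mem_facesSpace_iff.1 (hsub hp); exact ⟨F, hF, hpF⟩))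
  have hnot := erase_bot_notMem_prevFaces (K := simplexCx l.toFinset hind) (N := 1) (Sub := ∅)
    (a := 0) (D := ∅) hl hKL ht hσ (empty_subset _) (fun _ h => absurd h (notMem_empty _))
    (notMem_empty _) (fun _ h => absurd h (notMem_empty _)) hi'
  simp only [faceList_toFinset_self] at hnot
  exact hnot hmem

/-! ### After the last expansion the whole cell is present -/

include hl in
/-- The closed cell is the union of its closed staircase simplices. [folklore] -/
theorem prismCell_subset_iUnion_convexHull_stair (h01 : t 0 < t 1) :
    prismCell l.toFinset (t 0) (t 1) ⊆
      ⋃ i ∈ Finset.range l.length, convexHull ℝ (stair (t 0) (t 1) l i : Set (W × ℝ)) := by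
  intro p hp
  have hp' : p ∈ prismSet (t 0) (t 1) l := ⟨hp.1, hp.2⟩
  rw [← iUnion_prismFaces_eq h01 l hl] at hp'
  obtain ⟨F, ⟨-, i, hi, hFi⟩, hpF⟩ := mem_iUnion₂.1 hp'
  exact mem_iUnion₂.2 ⟨i, Finset.mem_range.2 hi, convexHull_mono (by exact_mod_cast hFi) hpF⟩

include hl hind ht in
/-- **After the last expansion the whole cell is present.** [folklore] -/
theorem prismCell_subset_facesSpace_prevFaces_length :
    prismCell l.toFinset (t 0) (t 1) ⊆
      facesSpace (prevFaces (simplexCx l.toFinset hind) l t 1 ∅ 0 ∅ l.toFinset l.length) := by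
  intro p hp
  have h01 : t 0 < t 1 := ht Nat.one_pos
  have hp' : p ∈ prismSet (t 0) (t 1) l := ⟨hp.1, hp.2⟩
  rw [← iUnion_prismFaces_eq h01 l hl] at hp'
  obtain ⟨F, hF, hpF⟩ := mem_iUnion₂.1 hp'
  have h := prismFaces_subset_prevFaces_length (K := simplexCx l.toFinset hind) (L := l) (t := t)
    (N := 1) (Sub := ∅) (a := 0) (D := ∅) (σ := l.toFinset)
  simp only [faceList_toFinset_self] at h
  exact mem_facesSpace_iff.2 ⟨F, h hF, hpF⟩

/-! ### The present faces are faces of the ambient product complex -/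

include hind in
/-- The faces present at stage `i` of the one-prism structure are prism faces, over the
nonempty subsets `ρ ⊆ τ`, of the slab `[t 0, t 1]` — hence faces of any product complex
containing these prisms. [folklore] -/
theorem exists_of_mem_prevFaces_onePrism (hne : l ≠ []) {i : ℕ} (hi : i ≤ l.length)
    {F : Finset (W × ℝ)} (hF : F ∈ prevFaces (simplexCx l.toFinset hind) l t 1 ∅ 0 ∅ l.toFinset i) :
    ∃ ρ : Finset W, ρ.Nonempty ∧ ρ ⊆ l.toFinset ∧ F ∈ prismFaces (t 0) (t 1) (faceList l ρ) := by
  have hσ := toFinset_mem_simplexCx_faces l hind hne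
  have h := prevFaces_subset_productFaces (K := simplexCx l.toFinset hind) (L := l) (t := t)
    (N := 1) (Sub := ∅) (a := 0) (D := ∅) (empty_subset _) Nat.one_pos (empty_subset _) hσ
    (by rw [faceList_toFinset_self]; exact hi) hF
  obtain ⟨a, ha, ρ, hρ, hFρ⟩ := mem_productFaces_iff.1 h
  have ha0 : a = 0 := by omega
  subst ha0
  rw [simplexCx_faces] at hρ
  exact ⟨ρ, hρ.1, hρ.2, hFρ⟩

end OnePrism

end Literature.Topology.FourManifolds

end
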